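import Literature.AlgebraicGeometry.HodgeTheory.GoursatKolchinRibetUnprimed
import Literature.Algebra.Lie.SpecialLinearAutomorphismsHolds
import HarnessLib

/-!
# The Goursat–Kolchin–Ribet criterion (Katz 1990, Prop. 1.8.2, special case `Gᵢ^{0,der} = SL(Vᵢ)`, on `ℂ`-points):
# BOTH named facts DISCHARGED

Layer `Literature/AlgebraicGeometry/HodgeTheory`. THEOREMS only. Composition of
`GoursatKolchinRibetHolds.Katz1990_goursatKolchinRibet_specialLinear'_of_jacobson` /
`GoursatKolchinRibetUnprimed.Katz1990_goursatKolchinRibet_specialLinear_of_jacobson` (Katz's proof: block kernels,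
"`G°` maps onto `Gᵢ°`", logarithms and Lie algebras, Ribet's and Goursat's lemmas, Schur) with the discharged
classification of `Aut 𝔰𝔩ₙ` (`Literature.Algebra.Lie.SpecialLinearAutomorphisms.Jacobson1962_sl_automorphisms_holds`,
Jacobson IX.5 Thm 5, proved in the tree by prover-Bx): the named facts
`Katz1990_goursatKolchinRibet_specialLinear'` and `Katz1990_goursatKolchinRibet_specialLinear` of
`GoursatKolchinRibetCriterion` are THEOREMS. Crux K1 `VeryGeneralDeckCommutatorsInHg`
(`Summits/HodgeConjecture/HodgeConjecture/Theses/CyclicUnitaryPowers.lean`, stmt-HodgeConjecture-19544) thereby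
loses its Goursat–Kolchin–Ribet debt (stub `stub_katzGKR`). Written by the prover seat `hodge-nonav-prover-Ax` (g3),
cell `hodge-nonav`.

## References
* [Katz1990ESDE] N. M. Katz, *Exponential Sums and Differential Equations* (1990), §1.8 Prop. 1.8.2.
* [Jacobson1962LieAlgebras] N. Jacobson, *Lie Algebras* (1962), Ch. IX §5 Theorem 5.
-/

noncomputable section

namespace Literature.AlgebraicGeometry.HodgeTheory

/-- **The Goursat–Kolchin–Ribet criterion, projection form (1′), HOLDS** (Katz 1990, Prop. 1.8.2 with
`Gᵢ^{0,der} = SL(Vᵢ)`, on `ℂ`-points): the named fact `Katz1990_goursatKolchinRibet_specialLinear'` is a theorem.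
[cite: Katz1990ESDE, §1.8 Prop. 1.8.2] [cite: Jacobson1962LieAlgebras, Ch. IX §5 Theorem 5 (p. 283)] -/
theorem Katz1990_goursatKolchinRibet_specialLinear'_holds : Katz1990_goursatKolchinRibet_specialLinear' :=
  Katz1990_goursatKolchinRibet_specialLinear'_of_jacobson
    Literature.Algebra.Lie.SpecialLinearAutomorphisms.Jacobson1962_sl_automorphisms_holds

/-- **The Goursat–Kolchin–Ribet criterion, lift form (1), HOLDS**: the named fact
`Katz1990_goursatKolchinRibet_specialLinear` is a theorem. [cite: Katz1990ESDE, §1.8 Prop. 1.8.2]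
[cite: Jacobson1962LieAlgebras, Ch. IX §5 Theorem 5 (p. 283)] -/
theorem Katz1990_goursatKolchinRibet_specialLinear_holds : Katz1990_goursatKolchinRibet_specialLinear :=
  Katz1990_goursatKolchinRibet_specialLinear_of_jacobson
    Literature.Algebra.Lie.SpecialLinearAutomorphisms.Jacobson1962_sl_automorphisms_holds

end Literature.AlgebraicGeometry.HodgeTheory

end
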